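import Summits.ValiantsHypothesis.ValiantsHypothesis.Theorems.LacunarySymmetroidMatrixDescartesCensusDoorA34SheetEndParity

/-!
# `MatrixDescartes` census — DOOR A at `(3,4)`: the OPEN CONTENT of `stub_nullTopCeiling` and `stub_nullNullCeiling` as EQUIVALENT typed statements
# (the stubs ⟺ their restriction to the open half-sheet with all slot coefficients non-zero and pairwise distinct slot exponents)

HONEST FRAMING.  Object-search cell `pub-symmetroid`, engine seat `val-sym-eng-2` (g4); helper row beside the registered strata line
`Cruxes/DoorA34/Lines/strata.lean` on stmt-ValiantsHypothesis-19980 (`DoorA34 = PosRootLawAt 3 4 18`: OPEN, typed, never asserted here).  Nothing is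
reshaped here (the planner owns the skeleton); this file only records, as kernel `iff`s with the stubs' binder shapes VERBATIM on the left, what this seat's
anatomy (…NullTopEighteenAnatomy / …NullNullSeventeenAnatomy) and end-parity (…SheetEndParity) rows make of the two ceilings:

* **`nullTopCeiling_iff_openHalfSheet`** — [∀ d S, symmetric, `StrictMono d`, `det S₃ = 0` ⇒ `≤ 17`] ⟺ [the same conclusion assumed ONLY for pencils with
  `0 < det S₀ · tr(adj S₃·S₂)`, `det S₀ · tr(adj S₀·S₁) < 0`, all `19` sheet slot coefficients non-zero and the `19` slot exponents pairwise distinct];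
* **`nullNullCeiling_iff_openHalfSheet`** — [∀ d S, symmetric, `StrictMono d`, `det S₀ = det S₃ = 0` ⇒ `≤ 16`] ⟺ [the same assumed only with
  `tr(adj S₀·S₁) · tr(adj S₃·S₂) < 0`, all `18` slot coefficients non-zero, slot exponents pairwise distinct].

So a prover of either stub may assume, for free, a Descartes-sharp word on the open half-sheet.  Nothing here bounds anything; `DoorA34` and the three stubs
stay OPEN; registers unchanged; nothing on `MatrixDescartes` (stmt-ValiantsHypothesis-18050) or `VP ≠ VNP` — VP≠VNP not moved.  [folklore] bookkeeping.
-/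

-- `Summit.ValiantsHypothesis.ValiantsHypothesis.…` repeats a component by the D-0017 layout
-- (single-conjunct summit), which the `dupNamespace` linter flags; the name is mandated.
set_option linter.dupNamespace false

namespace Summit.ValiantsHypothesis.ValiantsHypothesis.Theorems.LacunarySymmetroidMatrixDescartes.Census

open Polynomial Finset
open scoped BigOperators Polynomial Matrix

/-- **`stub_nullTopCeiling` ⟺ its open-half-sheet restriction.** [folklore] -/
theorem nullTopCeiling_iff_openHalfSheet :
    (∀ (d : Fin 4 → ℕ) (S : Fin 4 → Matrix (Fin 3) (Fin 3) ℝ), (∀ l, (S l).IsSymm) → StrictMono d → (S 3).det = 0 →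
      ((∑ l, (Polynomial.X : Polynomial ℝ) ^ d l • (S l).map Polynomial.C).det.roots.toFinset.filter (fun t => 0 < t)).card ≤ 17) ↔
    (∀ (d : Fin 4 → ℕ) (S : Fin 4 → Matrix (Fin 3) (Fin 3) ℝ), (∀ l, (S l).IsSymm) → StrictMono d → (S 3).det = 0 →
      0 < (S 0).det * ((S 3).adjugate * S 2).trace →
      (S 0).det * ((S 0).adjugate * S 1).trace < 0 →
      (∀ s : Sym (Fin 4) 3, s ≠ Sym.replicate 3 3 →
        ((∑ l, (Polynomial.X : Polynomial ℝ) ^ d l • (S l).map Polynomial.C).det).coeff (((s : Multiset (Fin 4)).map d).sum) ≠ 0) →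
      Set.InjOn (fun s : Sym (Fin 4) 3 => ((s : Multiset (Fin 4)).map d).sum)
        ↑((Finset.univ : Finset (Sym (Fin 4) 3)).erase (Sym.replicate 3 3)) →
      ((∑ l, (Polynomial.X : Polynomial ℝ) ^ d l • (S l).map Polynomial.C).det.roots.toFinset.filter (fun t => 0 < t)).card ≤ 17) := by
  constructor
  · intro h d S hS hd h3 _ _ _ _
    exact h d S hS hd h3
  · intro h d S hS hd h3
    by_contra hlt
    have h18 : 18 ≤ ((∑ l, (Polynomial.X : Polynomial ℝ) ^ d l • (S l).map Polynomial.C).det.roots.toFinset.filter (fun t => 0 < t)).card := by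
      omega
    have h1 := det_bottom_mul_trace_top_pos_of_nullTop_eighteen d hd S h3 h18
    have h2 := det_bottom_mul_trace_bottom_neg_of_nullTop_eighteen d hd S h3 h18
    have h4 := coeff_sym_sum_ne_zero_of_nullTop_eighteen d S h3 h18
    have h5 := sym_sum_injOn_of_nullTop_eighteen d S h3 h18
    exact hlt (h d S hS hd h3 h1 h2 h4 h5)

/-- **`stub_nullNullCeiling` ⟺ its open-half-sheet restriction.** [folklore] -/
theorem nullNullCeiling_iff_openHalfSheet :
    (∀ (d : Fin 4 → ℕ) (S : Fin 4 → Matrix (Fin 3) (Fin 3) ℝ), (∀ l, (S l).IsSymm) → StrictMono d → (S 0).det = 0 → (S 3).det = 0 →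
      ((∑ l, (Polynomial.X : Polynomial ℝ) ^ d l • (S l).map Polynomial.C).det.roots.toFinset.filter (fun t => 0 < t)).card ≤ 16) ↔
    (∀ (d : Fin 4 → ℕ) (S : Fin 4 → Matrix (Fin 3) (Fin 3) ℝ), (∀ l, (S l).IsSymm) → StrictMono d → (S 0).det = 0 → (S 3).det = 0 →
      ((S 0).adjugate * S 1).trace * ((S 3).adjugate * S 2).trace < 0 →
      (∀ s : Sym (Fin 4) 3, s ≠ Sym.replicate 3 3 → s ≠ Sym.replicate 3 0 →
        ((∑ l, (Polynomial.X : Polynomial ℝ) ^ d l • (S l).map Polynomial.C).det).coeff (((s : Multiset (Fin 4)).map d).sum) ≠ 0) →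
      Set.InjOn (fun s : Sym (Fin 4) 3 => ((s : Multiset (Fin 4)).map d).sum)
        ↑(((Finset.univ : Finset (Sym (Fin 4) 3)).erase (Sym.replicate 3 3)).erase (Sym.replicate 3 0)) →
      ((∑ l, (Polynomial.X : Polynomial ℝ) ^ d l • (S l).map Polynomial.C).det.roots.toFinset.filter (fun t => 0 < t)).card ≤ 16) := by
  constructor
  · intro h d S hS hd h0 h3 _ _ _
    exact h d S hS hd h0 h3
  · intro h d S hS hd h0 h3
    by_contra hlt
    have h17 : 17 ≤ ((∑ l, (Polynomial.X : Polynomial ℝ) ^ d l • (S l).map Polynomial.C).det.roots.toFinset.filter (fun t => 0 < t)).card := by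
      omega
    have h1 := trace_bottom_mul_trace_top_neg_of_nullNull_seventeen d hd S h0 h3 h17
    have h4 := coeff_sym_sum_ne_zero_of_nullNull_seventeen d S h0 h3 h17
    have h5 := sym_sum_injOn_of_nullNull_seventeen d S h0 h3 h17
    exact hlt (h d S hS hd h0 h3 h1 h4 h5)

end Summit.ValiantsHypothesis.ValiantsHypothesis.Theorems.LacunarySymmetroidMatrixDescartes.Census
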